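import Summits.Ventures.PercRepro.RankLevelSetUpSeriesClass

/-! # RankLevelSetUpSeriesClaimLocal — A LOCAL SUFFICIENT CONDITION FOR THE CLAIM ON ELEMENTARY QUOTIENT PAIRS:
THE FREE MEMBERS INJECT INTO `ḡ_3`, AND THE LINE MEMBERS INTO `Ā_5` WHEN EACH HAS `≥ 10` CHILDREN (night-1 g38;
dossier §50.6; on `RankLevelSetUpSeriesClass`)

A through-`b` member `W` of the mixed family at level `4` is FREE when `insert p (W ∖ {b})` spans (then `W ∖ {b}` is an
avoid-`b` bi-spanning `3`-set of the contraction: **`free_le_avoidHat_three`**, the injection `W ↦ W ∖ {b}`) and a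
LINE member otherwise (`W ∖ {b}` spans a hyperplane through `p` missing `b`). A line member's CHILDREN are the avoid-`b`
members `Z` at level `5` containing `W ∖ {b}`; a `Z` has at most `C(5,3) = 10` line parents. Hence if every line
member has at least `10` children, the line members are at most `Ā_5` (**`line_le_avoidFull_five_of_children`**) and
the claim follows (**`upSeriesClaim_of_children`**). This reduces `UpSeriesClaim` to a LOCAL count on the line
members — true for most instances (the children are the pairs `{e, x} ⊆ E' ∖ W` with `e` outside the hyperplane and
`(E' ∖ W) ∖ {e, x} ∪ {b, p}` spanning), false for some small `#E'` where the non-taken `ḡ_3`-sets must be used.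
Every declaration has a docstring; imports: the cell's own modules and Mathlib only. Axioms: standard. -/

namespace PercRepro

open Set Matroid

variable {α : Type} (N : Matroid α) [N.Finite]

/-- **The free members inject into `ḡ_3`**: `W ↦ W ∖ {b}`. -/
theorem free_le_avoidHat_three (p b : α) :
    {W ∈ upFull N p b 4 | N.Spanning (insert p (W \ {b}))}.ncard ≤ (avoidHat N p b 3).ncard := by
  classical
  refine Set.ncard_le_ncard_of_injOn (fun W => W \ {b}) ?_ ?_ (avoidHat_finite N p b 3)
  · rintro W ⟨⟨hWE, hW4, hbW, -, hWc⟩, hfree⟩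
    refine ⟨Set.sdiff_subset.trans hWE, ?_, fun h => h.2 rfl, hfree, ?_⟩
    · rw [Set.ncard_sdiff_singleton_of_mem hbW, hW4]
    · refine hWc.superset (Set.insert_subset_insert ?_)
        (Set.insert_subset (hWc.subset_ground (Set.mem_insert p _)) (Set.sdiff_subset.trans Set.sdiff_subset))
      exact Set.sdiff_subset_sdiff_right Set.sdiff_subset
  · rintro W ⟨⟨-, -, hbW, -, -⟩, -⟩ W' ⟨⟨-, -, hbW', -, -⟩, -⟩ heq
    simp only at heq
    have h1 : insert b (W \ {b}) = insert b (W' \ {b}) := by rw [heq]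
    rwa [Set.insert_sdiff_singleton, Set.insert_sdiff_singleton, Set.insert_eq_of_mem hbW,
      Set.insert_eq_of_mem hbW'] at h1

/-- **The line members inject into `Ā_5` when each has `≥ 10` children** (`Z ∈ Ā_5` with `W ∖ {b} ⊆ Z`): every
`Z` has at most `C(5,3) = 10` line parents, so `10 · #line ≤ #incidences ≤ 10 · Ā_5`. -/
theorem line_le_avoidFull_five_of_children (p b : α)
    (hch : ∀ W ∈ upFull N p b 4, ¬ N.Spanning (insert p (W \ {b})) →
      10 ≤ {Z ∈ avoidFull N p b 5 | W \ {b} ⊆ Z}.ncard) :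
    {W ∈ upFull N p b 4 | ¬ N.Spanning (insert p (W \ {b}))}.ncard ≤ (avoidFull N p b 5).ncard := by
  classical
  have hAfin : {W ∈ upFull N p b 4 | ¬ N.Spanning (insert p (W \ {b}))}.Finite :=
    (upFull_finite N p b 4).subset (fun _ h => h.1)
  have hBfin := avoidFull_finite N p b 5
  set I : Finset (Set α × Set α) := (hAfin.toFinset ×ˢ hBfin.toFinset).filter (fun q => q.1 \ {b} ⊆ q.2) with hI
  -- LOWER BOUND: `10 · #line ≤ #I`
  have hlow : 10 * hAfin.toFinset.card ≤ I.card := by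
    refine Finset.mul_card_image_le_card_of_maps_to (f := Prod.fst) ?_ _ ?_
    · intro q hq
      rw [hI, Finset.mem_filter, Finset.mem_product] at hq
      exact hq.1.1
    · intro W hW
      have hWA := hAfin.mem_toFinset.mp hW
      have h10 := hch W hWA.1 hWA.2
      have hfin : {Z ∈ avoidFull N p b 5 | W \ {b} ⊆ Z}.Finite := hBfin.subset (fun _ h => h.1)
      calc 10 ≤ {Z ∈ avoidFull N p b 5 | W \ {b} ⊆ Z}.ncard := h10
        _ = ((fun Z => (W, Z)) '' {Z ∈ avoidFull N p b 5 | W \ {b} ⊆ Z}).ncard :=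
            (Set.injOn_of_injective (fun Z Z' h => congrArg Prod.snd h)).ncard_image.symm
        _ ≤ (I.filter (fun q => q.1 = W)).card := by
            rw [← Set.ncard_coe_finset]
            refine Set.ncard_le_ncard ?_ (Finset.finite_toSet _)
            rintro q ⟨Z, ⟨hZ, hWZ⟩, rfl⟩
            rw [Finset.mem_coe, Finset.mem_filter, hI, Finset.mem_filter, Finset.mem_product]
            exact ⟨⟨⟨hW, hBfin.mem_toFinset.mpr hZ⟩, hWZ⟩, rfl⟩
  -- UPPER BOUND: `#I ≤ 10 · Ā_5` — the parents of `Z` inject into its `3`-subsets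
  have hup : I.card ≤ 10 * hBfin.toFinset.card := by
    refine Finset.card_le_mul_card_image_of_maps_to (f := Prod.snd) ?_ _ ?_
    · intro q hq
      rw [hI, Finset.mem_filter, Finset.mem_product] at hq
      exact hq.1.2
    · intro Z hZ
      have hZB := hBfin.mem_toFinset.mp hZ
      have hZfin : Z.Finite := N.ground_finite.subset (hZB.1.trans Set.sdiff_subset)
      have hsub : ((I.filter (fun q => q.2 = Z)) : Set (Set α × Set α)).ncard ≤
          {S | S ⊆ Z ∧ S.ncard = 3}.ncard := by
        refine Set.ncard_le_ncard_of_injOn (fun q => q.1 \ {b}) ?_ ?_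
          (hZfin.finite_subsets.subset (fun _ h => h.1))
        · intro q hq
          rw [Finset.mem_coe, Finset.mem_filter, hI, Finset.mem_filter, Finset.mem_product] at hq
          obtain ⟨⟨⟨hqA, -⟩, hsub⟩, hq2⟩ := hq
          have hqA' := hAfin.mem_toFinset.mp hqA
          refine ⟨hq2 ▸ hsub, ?_⟩
          rw [Set.ncard_sdiff_singleton_of_mem hqA'.1.2.2.1, hqA'.1.2.1]
        · intro q hq q' hq' heq
          rw [Finset.mem_coe, Finset.mem_filter, hI, Finset.mem_filter, Finset.mem_product] at hq hq'
          have hbq := (hAfin.mem_toFinset.mp hq.1.1.1).1.2.2.1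
          have hbq' := (hAfin.mem_toFinset.mp hq'.1.1.1).1.2.2.1
          simp only at heq
          have h1 : insert b (q.1 \ {b}) = insert b (q'.1 \ {b}) := by rw [heq]
          rw [Set.insert_sdiff_singleton, Set.insert_sdiff_singleton, Set.insert_eq_of_mem hbq,
            Set.insert_eq_of_mem hbq'] at h1
          exact Prod.ext h1 (hq.2.trans hq'.2.symm)
      rw [Set.ncard_coe_finset, Set.ncard_powerset_ncard hZfin, hZB.2.1] at hsub
      exact hsub
  rw [Set.ncard_eq_toFinset_card _ hAfin, Set.ncard_eq_toFinset_card _ hBfin]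
  have := hlow.trans hup
  omega

/-- **THE CLAIM FROM THE LOCAL CHILDREN CONDITION**: if every line member has `≥ 10` children, then
`A_4 ≤ Ā_5 + ḡ_3`. -/
theorem upSeriesClaim_of_children (p b : α)
    (hch : ∀ W ∈ upFull N p b 4, ¬ N.Spanning (insert p (W \ {b})) →
      10 ≤ {Z ∈ avoidFull N p b 5 | W \ {b} ⊆ Z}.ncard) : UpSeriesClaim N p b := by
  classical
  unfold UpSeriesClaim
  have hsplit : upFull N p b 4 = {W ∈ upFull N p b 4 | N.Spanning (insert p (W \ {b}))} ∪
      {W ∈ upFull N p b 4 | ¬ N.Spanning (insert p (W \ {b}))} := by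
    ext W; simp only [Set.mem_union, Set.mem_setOf_eq]; tauto
  have hle := Set.ncard_union_le {W ∈ upFull N p b 4 | N.Spanning (insert p (W \ {b}))}
    {W ∈ upFull N p b 4 | ¬ N.Spanning (insert p (W \ {b}))}
  rw [← hsplit] at hle
  calc (upFull N p b 4).ncard
      ≤ {W ∈ upFull N p b 4 | N.Spanning (insert p (W \ {b}))}.ncard +
          {W ∈ upFull N p b 4 | ¬ N.Spanning (insert p (W \ {b}))}.ncard := hle
    _ ≤ (avoidHat N p b 3).ncard + (avoidFull N p b 5).ncard :=
        Nat.add_le_add (free_le_avoidHat_three N p b) (line_le_avoidFull_five_of_children N p b hch)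
    _ = (avoidFull N p b 5).ncard + (avoidHat N p b 3).ncard := Nat.add_comm _ _

end PercRepro
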